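import Summits.AnomalousDissipation.AnomalousDissipation.Theses.CriticalLayer
import Summits.AnomalousDissipation.AnomalousDissipation.Theses.Correlation
import Summits.AnomalousDissipation.AnomalousDissipation.Theorems.ImpulseGridBoundedEnergyNoLeakGridOfNoMeanLeakage
import HarnessLib

/-!
# Birth skeleton (BC3) for the piece `CriticalLayer.NoMeanLeakage` (stmt-AnomalousDissipation-14265) of the BC2 redirect
# of `KolmogorovObliqueThesis` (stmt-AnomalousDissipation-1010)

Line `energy-class-upgrade`: no Leray–Hopf leakage IN THE MEAN follows from (i) EVENTUAL energy EQUALITY of every global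
Leray–Hopf solution on `T³` under a smooth steady force (the hard, conjectural stub — implied by eventual regularity at fixed
`ν`, open at large Grashof; FMRT 2001 p. 71, RRS 2016 §4.3) and (ii) the Cesàro bookkeeping that turns the pathwise equality on
`[T₀, ∞)` plus the absorbing ball (PROVED: `Theorems.absorbingBallLHTorus_of_stub`) into the inequality of long-time means
(provable, M: measurability of `t ↦ ‖∇u(t)‖₂²` from the joint measurability of the Leray–Hopf field, `(∫⁻ G).toReal = ∫ G.toReal`
on finite-energy windows, boundary terms `O(1)/T → 0`, `limsup (a + o(1)) = limsup a`).  Two registered stubs, the composition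
`noMeanLeakage_of` is proved.
-/

set_option linter.dupNamespace false

noncomputable section

open MeasureTheory Filter Set
open scoped InnerProductSpace RealInnerProductSpace ENNReal
open Literature.Analysis.FunctionSpaces Literature.Analysis.FunctionSpaces.Torus
open Literature.Analysis.FluidPDE Literature.Analysis.FluidPDE.Torus
open Summit.AnomalousDissipation.AnomalousDissipation.Theses

namespace Summit.AnomalousDissipation.AnomalousDissipation.Cruxes.KolmogorovObliqueThesis.BirthNoMeanLeakage

local notation "𝕋³" => UnitAddTorus (Fin 3)
local notation "E³" => EuclideanSpace ℝ (Fin 3)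

/-- **stub (hardest) — eventual energy equality of forced Leray–Hopf solutions on `T³`.** For `ν > 0`, a smooth
divergence-free mean-zero steady force and EVERY global Leray–Hopf solution there is a time `T₀ ≥ 0` after which the energy
EQUALITY holds on every window `[s, t]`, `T₀ ≤ s ≤ t` (spectral dissipation `eGradNormSq`).  Implied by eventual regularity
(strong solutions satisfy the energy equality, RRS 2016 Thm 6.5); open in general (FMRT 2001 p. 71). -/
theorem stub_eventualEnergyEquality :
    ∀ (ν : ℝ) (f : 𝕋³ → E³) (u₀ : 𝕋³ → E³) (u : ℝ → 𝕋³ → E³), 0 < ν → IsSmooth f → IsDivFree f → HasZeroMean f →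
      IsGlobalLerayHopf ν (fun _ => f) u₀ u →
      ∃ T₀ : ℝ, 0 ≤ T₀ ∧ ∀ s t : ℝ, T₀ ≤ s → s ≤ t →
        kineticEnergy (u t) + ν * (∫⁻ τ in Ioo s t, eGradNormSq (u τ)).toReal =
          kineticEnergy (u s) + ∫ τ in s..t, ∫ x, ⟪f x, u τ x⟫ := by
  sorry

/-- **stub — Cesàro bookkeeping (provable, M).** For a global Leray–Hopf solution with a forward kinetic-energy cap and the
energy equality on every window after `T₀`, the limsup-mean work does not exceed the limsup-mean viscous dissipation
(`meanDissipation`, interval-integral/`toReal` form): divide the equality on `[T₀, T]` by `T`, the kinetic terms are `O(1)/T`,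
and `(∫⁻_{(T₀,T)} ‖∇u‖²).toReal = ∫_{T₀}^{T} ‖∇u(τ)‖².toReal dτ` (a.e. finiteness + measurability in time from the Leray–Hopf
class). -/
theorem stub_meanBudgetOfEventualEquality :
    ∀ (ν : ℝ) (f : 𝕋³ → E³) (u₀ : 𝕋³ → E³) (u : ℝ → 𝕋³ → E³) (T₀ C : ℝ), 0 < ν → 0 ≤ T₀ →
      IsGlobalLerayHopf ν (fun _ => f) u₀ u → (∀ t : ℝ, 0 ≤ t → kineticEnergy (u t) ≤ C) →
      (∀ s t : ℝ, T₀ ≤ s → s ≤ t →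
        kineticEnergy (u t) + ν * (∫⁻ τ in Ioo s t, eGradNormSq (u τ)).toReal =
          kineticEnergy (u s) + ∫ τ in s..t, ∫ x, ⟪f x, u τ x⟫) →
      longTimeAvgSup (fun t => ∫ x, ⟪f x, u t x⟫) ≤ meanDissipation ν u := by
  sorry

/-- **Composition (proved, kernel-checked modulo the two stubs): the piece `NoMeanLeakage` by name** (item stmt-14265, home decl `Correlation.NoMeanLeakage`, shared with route CriticalLayer), the forward
cap being the landed absorbing ball `Theorems.absorbingBallLHTorus_of_stub` (= `Correlation.AbsorbingBallLHTorus`, FMRT 2001 (A.41)–(A.42)). -/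
theorem NoMeanLeakage_of : Correlation.NoMeanLeakage := by
  intro ν f u₀ u hν hfs hfd hf0 hLH
  obtain ⟨T₀, hT₀, heq⟩ := stub_eventualEnergyEquality ν f u₀ u hν hfs hfd hf0 hLH
  obtain ⟨C, hC⟩ := Theorems.absorbingBallLHTorus_of_stub ν f u₀ u hν hfs hf0 hLH
  exact stub_meanBudgetOfEventualEquality ν f u₀ u T₀ C hν hT₀ hLH hC heq

/-- The same composition read as route CriticalLayer's copy of the shared item (the two decls have identical bodies). -/
theorem NoMeanLeakage_of_criticalLayer : CriticalLayer.NoMeanLeakage :=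
  NoMeanLeakage_of

end Summit.AnomalousDissipation.AnomalousDissipation.Cruxes.KolmogorovObliqueThesis.BirthNoMeanLeakage

end
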